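import Literature.MathematicalPhysics.QuantumFieldTheory.Balaban1983to89.B9Thm37CubeCoverCommutatorSizes

/-!
# `Balaban1983to89.B9Thm37CubeCoverCommutatorSizesGrad` — T. Bałaban, *Propagators for lattice gauge theories in a background field*,
# Commun. Math. Phys. **99** (1985) 389–434 [Balaban1985BackgroundPropagators], Sect. C p. 409, (3.88)–(3.89) («Using the inequalities (3.42) for
# G′_□» — plural: the sup AND the gradient entry): THE PRINT-SHAPE SIZES OF `K(h_□)(U)` WITH THE LEVEL FACTORS KEPT — the first-order part against the
# COVARIANT GRADIENT `∇_UΛ` (coefficient `|∂h_□| = O(1)∕S_j`), the zeroth-order parts with the second difference `|Δh_□| = O(1)∕S_j²` and the averaging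
# weight `a_{lev z}·L^{−2·lev z}` VISIBLE (sub-row G-B9-LETTERS, module M5.4-comb, file C; M5.4-est feeds these with (3.42)₁,₂ for `G′_□h_□λ`)

statement-level skeleton of published theorems with citation tags; proofs where landed; nothing here is a claim about the Yang–Mills mass gap

PDF held: `paper:balaban1985-cmp99-background-propagators` (journal page = PDF page + 388); p. 409 read as page image `…-p021-x2.png`.  [4] =
[Balaban1984PropagatorsII], p. 230 (2.40)∕(2.43)–(2.44), p. 247.

CITATION HEADER (lean-in-tree rule) — WHAT IS PRINTED AND WHY THIS FILE.  p. 409: *«Using the inequalities (3.42) for G′_□, we get the bound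
|(K(h_□)G′_□h_□λ)(x)| ≤ O(M⁻¹)e^{−δ₀(Lʲη)⁻¹|y−y′|}|λ| (3.89)»*; [4] p. 230: *«|(G′(□)λ)(x)|, |(∂^{L^{−j}}_μG′(□)λ)(x)| ≤ O(1)e^{−δ₀dist(x, supp λ)}|λ|. (2.43)
This inequality and (2.40) imply |(K(h_□)G′(□)h_□λ)(x)| ≤ O(M⁻¹)e^{−δ₀|x−y|}|λ| (2.44)»*.  The `O(M⁻¹)` is UNIFORM IN THE LEVEL `j` because `K(h)` is
FIRST ORDER: its bond part `Σ_{b∈st(x)}(∂h)(b)(D_Uλ)(b)` meets the GRADIENT entry (3.42)₂ (`|∂h_□|·|∇_UG′λ| ≤ O(1)(MLʲη)⁻¹·B₀(Lʲη)e^{…} = O(M⁻¹)B₀e^{…}`),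
its site part `(Δh)(x)λ(x)` the sup entry with TWO powers of `(MLʲη)⁻¹`, and the averaging line carries `a_j(Lʲη)⁻²` against the sup entry's `(Lʲη)²`.
File B (`…B9Thm37CubeCoverCommutatorSizes`, p593694) bounds every term by the SUP of `Λ` over the stencil — correct, but against (3.42)₁ alone that
costs a factor `L^{j−1}`.  THIS FILE states the sizes in print's shape so that the est half cancels the level factors as print does.

CELL ∕ SUB-ROW.  Cell `lit-balaban`, sub-row G-B9-LETTERS, module **M5.4-comb** file C; seat p38 gen 37 (literature-prover-lit-balaban-p38-g37-0); files
A∕B = `…B9Thm37CubeCoverCommutators` (p593034) ∕ `…Sizes` (p593694).  SKELETON rows B9.Thm3.7 × B9.Def@408 (cells only).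

## WHAT THIS FILE PROVES (kernel-checked, 0 sorry, standard axioms; THEOREMS ONLY — no `def`, no new fact)
* §1 `norm_cutCommY_lapSL_apply_le_grad` — the covariant-Laplacian line of (3.88) in PRINT'S SHAPE, sized WITHOUT any transporter hypothesis:
  `‖(K_Δ(h)Λ)(z)‖ ≤ Σ_μ (|h(z+e_μ) − h z|·‖(∇_{U,μ}Λ)(z)‖ + |h(z−e_μ) − h z|·‖(∇*_{U,μ}Λ)(z)‖) + |Σ_μ (h(z+e_μ) + h(z−e_μ) − 2h z)|·‖Λ z‖`;
  `norm_KhY_apply_le_grad` — plus the averaging line `Σ_w |avgCoeffY(z,w)|·|h z − h w|·‖Λ w‖` (contraction-pair averaging transporters).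
* §2 at the partition of record `h_□ = hTY i c` (□ of level `j`, `S_j = bigSide ℓ M_h j = M_h·L^{j+1}`): `abs_laplace_hTY_le` — the second difference
  `|Σ_μ (h_□(z+e_μ) + h_□(z−e_μ) − 2h_□(z))| ≤ (d+1)·C2F∕(8∕5·S_j)²` (this seat's gen-26 `abs_hT_second_diff_le`; print's `|Δh_□| ≤ O(1)(MLʲη)⁻²`);
  `sum_abs_avgCoeffY_le_levFactor` — the averaging weight at `z` is `≤ (L^{lev z})⁻²` (file B proved `≤ 1`; here the level factor is kept).
* §3 ★★ `norm_KhY_hTY_apply_le_grad` — **THE `G′`-FREE HALF OF (3.89) IN PRINT'S SHAPE**: for gradient data `G₁ ≥ ‖(∇_{U,μ}Λ)(z)‖, ‖(∇*_{U,μ}Λ)(z)‖`,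
  the site value `‖Λ z‖ ≤ G₀` and block data `Gb ≥ ‖Λ w‖` on the averaging block of `z`:
  `‖(K(h_□)(U)Λ)(z)‖ ≤ (2(d+1)·C1F∕(8∕5·S_j))·G₁ + ((d+1)·C2F∕(8∕5·S_j)²)·G₀ + ((L^{lev z})⁻²·sLipT∕(L·M_h))·Gb` — with `S_j⁻¹ ≤ (L·M_h)⁻¹·L^{−j}`:
  fed with (3.42)₂ (`G₁ ~ B₀·Lʲ·e^{−δ₀d}`), (3.42)₁ (`G₀, Gb ~ B₀·L^{2j}·e^{−δ₀d}`) and `lev z ≥ j − 1` on the stencil, every product is `O(1)∕M_h`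
  times `B₀e^{−δ₀d}`, uniformly in `j` (M5.4-est's arithmetic; not done here).
HONEST SCOPE.  As files A∕B: lattice units, def-Y's carrier, member side conditions from `KIdx`; the transporter hypothesis is needed ONLY for the averaging
line (the covariant derivatives already contain `R(U_b)`); nothing of (3.42) or (3.89) itself is asserted; nothing continuum ∕ OS ∕ mass gap ∕ Clay; YM
mass gap NOT proved by any of this (Track A conditional rung).  `--supports stmt-QuantumFields-19200`.  Net new unproved facts: 0.
-/

noncomputable section

namespace Literature.MathematicalPhysics.QuantumFieldTheory.Balaban1983to89.B9Thm37CubeCoverCommutatorSizesGrad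

open Node00
open B9Thm37CubeCoverCommutators
open B9Thm37CubeCoverCommutatorSizes
open B6KLevelCensusIndexV1 (KIdx)
open B4Reflection242 (boxDom blk)
open B6MultiLevelBoxOperator (N0 bigSide bigSide_eq levC aPrinted)
open B6MultiLevelTorusOperator (tshift unitVec tshift_symm_apply)
open B6Cover236MultiLevelBlocks (cubes)
open B6Partition118KLevelTorus (hT)
open B6Partition118KLevelFineSizes (C1F C1F_nonneg)
open B6Partition118KLevelFineSecond (C2F C2F_nonneg)
open B6Partition118KLevelTorusBinders (sLipT sLipT_nonneg abs_hT_second_diff_le)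
open B9Eq39Adjoint (R)
open scoped Matrix

variable {𝔸 : Type} [NormedRing 𝔸] [NormedAlgebra ℂ 𝔸] [CompleteSpace 𝔸]
variable {d ℓ : ℕ} {hd : 1 ≤ d + 1} {hL : Odd (ℓ + 1) ∧ 1 < ℓ + 1} {b₀ b₁ : ℝ}
variable (i : KIdx d ℓ hd hL b₀ b₁)

/-! ## §1 The sizes in print's shape: first-order part against the covariant gradient -/

/-- ★ **THE COVARIANT-LAPLACIAN LINE OF (3.88) IN PRINT'S SHAPE, SIZED**: no hypothesis on the transporters (the covariant derivatives carry them).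
`‖(K_Δ(h)Λ)(z)‖ ≤ Σ_μ (|h(z+e_μ) − h z|·‖(∇_{U,μ}Λ)(z)‖ + |h(z−e_μ) − h z|·‖(∇*_{U,μ}Λ)(z)‖) + |Σ_μ (h(z+e_μ) + h(z−e_μ) − 2h z)|·‖Λ z‖`.
[cite: Balaban1985BackgroundPropagators, (3.88) p.409 (first line); Balaban1984PropagatorsII, (2.40) p.230] -/
theorem norm_cutCommY_lapSL_apply_le_grad (U : CfgY 𝔸 i) (h : SiteY i → ℝ) (Λ : SiteY i → 𝔸) (z : SiteY i) :
    ‖cutCommY h (lapSL i U) Λ z‖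
      ≤ (∑ μ : Fin (d + 1),
          (|h (shiftY i μ z) - h z| * ‖cdS i U μ Λ z‖ + |h ((shiftY i μ).symm z) - h z| * ‖cdsS i U μ Λ z‖))
        + |∑ μ : Fin (d + 1), (h (shiftY i μ z) + h ((shiftY i μ).symm z) - 2 * h z)| * ‖Λ z‖ := by
  rw [cutCommY_lapSL_apply_print]
  refine le_trans (norm_add_le _ _) (add_le_add ?_ ?_)
  · refine le_trans (norm_sum_le _ _) (Finset.sum_le_sum fun μ _ => ?_)
    refine le_trans (norm_add_le _ _) (add_le_add ?_ ?_)
    · rw [norm_ofReal_smul]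
    · rw [norm_ofReal_smul]
  · rw [norm_ofReal_smul]

/-- ★ **`K(h)(U)` IN PRINT'S SHAPE, SIZED**: the first-order part against the covariant gradient, the site part against `Λ(z)`, the averaging line
against `Λ` on the block (contraction-pair averaging transporters).
[cite: Balaban1985BackgroundPropagators, (3.88)–(3.89) p.409; Balaban1984PropagatorsII, (2.40)∕(2.44) p.230] -/
theorem norm_KhY_apply_le_grad (par : SiteParY 𝔸 i) (h : SiteY i → ℝ) (U : CfgY 𝔸 i) (Λ : SiteY i → 𝔸) (z : SiteY i)
    (hT : ∀ w : SiteY i, ‖(avgTrY i par U z w : 𝔸)‖ ≤ 1 ∧ ‖(((avgTrY i par U z w)⁻¹ : 𝔸ˣ) : 𝔸)‖ ≤ 1) :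
    ‖KhY i par h U Λ z‖
      ≤ ((∑ μ : Fin (d + 1),
          (|h (shiftY i μ z) - h z| * ‖cdS i U μ Λ z‖ + |h ((shiftY i μ).symm z) - h z| * ‖cdsS i U μ Λ z‖))
        + |∑ μ : Fin (d + 1), (h (shiftY i μ z) + h ((shiftY i μ).symm z) - 2 * h z)| * ‖Λ z‖)
        + ∑ w, |avgCoeffY i z w| * |h z - h w| * ‖Λ w‖ := by
  rw [KhY_eq_add, LinearMap.add_apply, Pi.add_apply]
  refine le_trans (norm_add_le _ _) (add_le_add (norm_cutCommY_lapSL_apply_le_grad i U h Λ z) ?_)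
  rw [kernelTrOpY_apply]
  refine le_trans (norm_sum_le _ _) (Finset.sum_le_sum fun w _ => ?_)
  rw [norm_ofReal_smul, abs_mul]
  exact mul_le_mul_of_nonneg_left (norm_R_le_of_pair _ (hT w).1 (hT w).2 _) (mul_nonneg (abs_nonneg _) (abs_nonneg _))

/-! ## §2 The level-dependent sizes of the partition of record -/

/-- **THE SECOND DIFFERENCE OF `h_□`**: `|Σ_μ (h_□(z+e_μ) + h_□(z−e_μ) − 2h_□(z))| ≤ (d+1)·C2F∕(8∕5·S_j)²` (print: `|Δh_□| ≤ O(1)(MLʲη)⁻²`).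
[cite: Balaban1984PropagatorsII, p.247 («|Δh_□| ≤ O(1)(MLʲη)⁻²»); Balaban1985BackgroundPropagators, (3.88) p.409] -/
theorem abs_laplace_hTY_le (c : ↥(cubes i.D.toDomains)) (z : SiteY i) :
    |∑ μ : Fin (d + 1), (hTY i c (shiftY i μ z) + hTY i c ((shiftY i μ).symm z) - 2 * hTY i c z)|
      ≤ ((d : ℝ) + 1) * (C2F d ℓ / (8 / 5 * (bigSide ℓ i.Mh c.1.1 : ℝ)) ^ 2) := by
  obtain ⟨hℓ, hMh, hR, hP5⟩ := side_conditions i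
  have hterm : ∀ μ : Fin (d + 1), |hTY i c (shiftY i μ z) + hTY i c ((shiftY i μ).symm z) - 2 * hTY i c z|
      ≤ C2F d ℓ / (8 / 5 * (bigSide ℓ i.Mh c.1.1 : ℝ)) ^ 2 := fun μ => by
    have e1 : shiftY i μ z = tshift (toKT i).NB (unitVec μ) z := rfl
    have e2 : (shiftY i μ).symm z = tshift (toKT i).NB (-unitVec μ) z := tshift_symm_apply _ _ _
    have h := abs_hT_second_diff_le (D := i.D) hℓ hMh hR hP5 c μ z
    rw [e1, e2]
    have e3 : hTY i c (tshift (toKT i).NB (unitVec μ) z) + hTY i c (tshift (toKT i).NB (-unitVec μ) z) - 2 * hTY i c z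
        = hT i.D c (tshift (toKT i).NB (unitVec μ) z) - 2 * hT i.D c z + hT i.D c (tshift (toKT i).NB (-unitVec μ) z) := by
      simp only [hTY_apply]; ring
    rw [e3]
    exact h
  calc |∑ μ : Fin (d + 1), (hTY i c (shiftY i μ z) + hTY i c ((shiftY i μ).symm z) - 2 * hTY i c z)|
      ≤ ∑ μ : Fin (d + 1), |hTY i c (shiftY i μ z) + hTY i c ((shiftY i μ).symm z) - 2 * hTY i c z| := Finset.abs_sum_le_sum_abs _ _
    _ ≤ ∑ _μ : Fin (d + 1), C2F d ℓ / (8 / 5 * (bigSide ℓ i.Mh c.1.1 : ℝ)) ^ 2 := Finset.sum_le_sum fun μ _ => hterm μ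
    _ = ((d : ℝ) + 1) * (C2F d ℓ / (8 / 5 * (bigSide ℓ i.Mh c.1.1 : ℝ)) ^ 2) := by
        rw [Finset.sum_const, Finset.card_univ, Fintype.card_fin, nsmul_eq_mul]; push_cast; ring

/-- **THE AVERAGING WEIGHT WITH ITS LEVEL FACTOR**: `Σ_w |avgCoeffY(z,w)| ≤ (L^{lev z})⁻²` (exactly `a_{lev z}·L^{−2·lev z}` with `a_j ≤ 1`).
[cite: Balaban1984PropagatorsII, (2.13)–(2.14) p.225 («a_j(Lʲη)^{−2} Σ L^{−jd}»)] -/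
theorem sum_abs_avgCoeffY_le_levFactor (z : SiteY i) :
    ∑ w, |avgCoeffY i z w| ≤ ((((ℓ : ℝ) + 1) ^ levY i z) ^ 2)⁻¹ := by
  classical
  obtain ⟨hℓ, hMh, _, _⟩ := side_conditions i
  set n : ℕ := (ℓ + 1) ^ levY i z with hn
  have hn1 : 1 ≤ n := Nat.one_le_pow _ _ (Nat.succ_pos ℓ)
  have hterm : ∀ w : SiteY i, |avgCoeffY i z w|
      = if blk n w.1 = blk n z.1 then levC d ℓ (aPrinted ℓ 1) (levY i z) else 0 := fun w => by
    rw [abs_of_nonneg (avgCoeffY_nonneg i z w)]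
    rfl
  simp_rw [hterm]
  rw [Finset.sum_ite, Finset.sum_const_zero, add_zero, Finset.sum_const, nsmul_eq_mul]
  have hcard : ((Finset.univ.filter fun w : SiteY i => blk n w.1 = blk n z.1).card : ℝ) ≤ ((n : ℝ)) ^ (d + 1) := by
    have h1 : (Finset.univ.filter fun w : SiteY i => blk n w.1 = blk n z.1).card ≤ (B4Reflection242.blockOf n z.1).card := by
      refine Finset.card_le_card_of_injOn (fun w : SiteY i => (w.1 : Fin (d + 1) → ℤ)) (fun w hw => ?_) ?_
      · rw [Finset.mem_coe, Finset.mem_filter] at hw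
        exact (B4Reflection242.mem_blockOf hn1).2 hw.2
      · intro w _ w' _ hww'
        exact Subtype.ext hww'
    have h2 : (B4Reflection242.blockOf n z.1).card = n ^ (d + 1) := by
      unfold B4Reflection242.blockOf
      rw [Fintype.card_piFinset]
      simp only [Int.card_Ico, add_sub_cancel_left, Int.toNat_natCast, Finset.prod_const, Finset.card_univ, Fintype.card_fin]
    exact_mod_cast (h1.trans h2.le)
  have hL : (1 : ℝ) < (ℓ : ℝ) + 1 := by
    have : (1 : ℝ) ≤ ℓ := by exact_mod_cast hℓ
    linarith
  have hj : 1 ≤ levY i z := (toKT i).D.one_le_lev z.1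
  have ha1 : aPrinted ℓ 1 (levY i z) ≤ 1 := B1.aSeq_le (a := (1 : ℝ)) one_pos hL _ hj
  have hnR : (n : ℝ) = ((ℓ : ℝ) + 1) ^ levY i z := by rw [hn]; push_cast; ring
  have hnpos : (0 : ℝ) < (n : ℝ) := by exact_mod_cast hn1
  have hlevC : 0 ≤ levC d ℓ (aPrinted ℓ 1) (levY i z) := by
    unfold levC
    have ha0 : 0 < aPrinted ℓ 1 (levY i z) := B1.aSeq_pos (a := (1 : ℝ)) one_pos hL hj
    positivity
  calc ((Finset.univ.filter fun w : SiteY i => blk n w.1 = blk n z.1).card : ℝ) * levC d ℓ (aPrinted ℓ 1) (levY i z)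
      ≤ (n : ℝ) ^ (d + 1) * levC d ℓ (aPrinted ℓ 1) (levY i z) := mul_le_mul_of_nonneg_right hcard hlevC
    _ = aPrinted ℓ 1 (levY i z) * (((n : ℝ)) ^ 2)⁻¹ := by
        unfold levC
        rw [← hnR]
        field_simp
    _ ≤ 1 * (((n : ℝ)) ^ 2)⁻¹ := mul_le_mul_of_nonneg_right ha1 (by positivity)
    _ = ((((ℓ : ℝ) + 1) ^ levY i z) ^ 2)⁻¹ := by rw [one_mul, hnR]

/-! ## §3 The `G′`-free half of (3.89) in print's shape -/

/-- ★★ **THE `G′`-FREE HALF OF (3.89) IN PRINT'S SHAPE** (□ of level `j`, `S_j = M_h·L^{j+1}`): for gradient data `G₁`, the site value `G₀` and block data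
`Gb` of `Λ`,
`‖(K(h_□)(U)Λ)(z)‖ ≤ (2(d+1)·C1F∕(8∕5·S_j))·G₁ + ((d+1)·C2F∕(8∕5·S_j)²)·G₀ + ((L^{lev z})⁻²·sLipT∕(L·M_h))·Gb`.
With `Λ := G′_□h_□λ`, (3.42)₂ for `G₁` and (3.42)₁ for `G₀, Gb`, each product is `O(M⁻¹)B₀e^{−δ₀d}` uniformly in `j` — print's (3.89) (M5.4-est).
[cite: Balaban1985BackgroundPropagators, (3.89) p.409; Balaban1984PropagatorsII, (2.43)–(2.44) p.230] -/
theorem norm_KhY_hTY_apply_le_grad (par : SiteParY 𝔸 i) (c : ↥(cubes i.D.toDomains)) (U : CfgY 𝔸 i) (Λ : SiteY i → 𝔸) (z : SiteY i)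
    (hT : ∀ w : SiteY i, ‖(avgTrY i par U z w : 𝔸)‖ ≤ 1 ∧ ‖(((avgTrY i par U z w)⁻¹ : 𝔸ˣ) : 𝔸)‖ ≤ 1)
    {G₁ G₀ Gb : ℝ} (hG₁ : ∀ μ : Fin (d + 1), ‖cdS i U μ Λ z‖ ≤ G₁ ∧ ‖cdsS i U μ Λ z‖ ≤ G₁) (hG₀ : ‖Λ z‖ ≤ G₀)
    (hGb : ∀ w : SiteY i, avgCoeffY i z w ≠ 0 → ‖Λ w‖ ≤ Gb) :
    ‖KhY i par (hTY i c) U Λ z‖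
      ≤ (2 * ((d : ℝ) + 1) * (C1F d ℓ / (8 / 5 * (bigSide ℓ i.Mh c.1.1 : ℝ)))) * G₁
        + (((d : ℝ) + 1) * (C2F d ℓ / (8 / 5 * (bigSide ℓ i.Mh c.1.1 : ℝ)) ^ 2)) * G₀
        + (((((ℓ : ℝ) + 1) ^ levY i z) ^ 2)⁻¹ * (sLipT d ℓ / (((ℓ : ℝ) + 1) * i.Mh))) * Gb := by
  have hd1 : Nonempty (Fin (d + 1)) := ⟨0⟩
  have hG₁0 : 0 ≤ G₁ := le_trans (norm_nonneg _) (hG₁ 0).1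
  have hG₀0 : 0 ≤ G₀ := le_trans (norm_nonneg _) hG₀
  set κ₁ : ℝ := C1F d ℓ / (8 / 5 * (bigSide ℓ i.Mh c.1.1 : ℝ)) with hκ₁
  set κb : ℝ := sLipT d ℓ / (((ℓ : ℝ) + 1) * i.Mh) with hκb
  have hκb0 : 0 ≤ κb := div_nonneg (sLipT_nonneg d ℓ) (by positivity)
  refine (norm_KhY_apply_le_grad i par (hTY i c) U Λ z hT).trans ?_
  refine add_le_add (add_le_add ?_ ?_) ?_
  · -- the 2(d+1) bond terms: |∂h| ≤ κ₁, gradient ≤ G₁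
    have hstep : ∀ μ : Fin (d + 1),
        |hTY i c (shiftY i μ z) - hTY i c z| * ‖cdS i U μ Λ z‖ + |hTY i c ((shiftY i μ).symm z) - hTY i c z| * ‖cdsS i U μ Λ z‖
          ≤ 2 * (κ₁ * G₁) := fun μ => by
      have h1 : |hTY i c (shiftY i μ z) - hTY i c z| * ‖cdS i U μ Λ z‖ ≤ κ₁ * G₁ :=
        mul_le_mul (abs_hTY_shiftY_sub_le i c μ z) (hG₁ μ).1 (norm_nonneg _) (le_trans (abs_nonneg _) (abs_hTY_shiftY_sub_le i c μ z))
      have h2 : |hTY i c ((shiftY i μ).symm z) - hTY i c z| * ‖cdsS i U μ Λ z‖ ≤ κ₁ * G₁ :=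
        mul_le_mul (abs_hTY_shiftY_symm_sub_le i c μ z) (hG₁ μ).2 (norm_nonneg _)
          (le_trans (abs_nonneg _) (abs_hTY_shiftY_symm_sub_le i c μ z))
      linarith
    refine (Finset.sum_le_sum fun μ _ => hstep μ).trans ?_
    rw [Finset.sum_const, Finset.card_univ, Fintype.card_fin, nsmul_eq_mul]
    push_cast
    exact le_of_eq (by ring)
  · -- the site term: |Δh| ≤ (d+1)·C2F∕S², value ≤ G₀
    exact mul_le_mul (abs_laplace_hTY_le i c z) hG₀ (norm_nonneg _)
      (le_trans (abs_nonneg _) (abs_laplace_hTY_le i c z))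
  · -- the averaging line: |h z − h w| ≤ κb on the block, weight ≤ (L^{lev z})⁻², values ≤ Gb
    have h1 : ∀ w, |avgCoeffY i z w| * |hTY i c z - hTY i c w| * ‖Λ w‖ ≤ |avgCoeffY i z w| * (κb * Gb) := by
      intro w
      by_cases hw : avgCoeffY i z w = 0
      · rw [hw, abs_zero, zero_mul, zero_mul, zero_mul]
      · rw [mul_assoc]
        refine mul_le_mul_of_nonneg_left ?_ (abs_nonneg _)
        exact mul_le_mul (abs_hTY_sub_le_of_avgCoeffY_ne_zero i c hw) (hGb w hw) (norm_nonneg _) hκb0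
    refine (Finset.sum_le_sum fun w _ => h1 w).trans ?_
    rw [← Finset.sum_mul]
    have hGb0 : 0 ≤ κb * Gb := by
      by_cases hex : ∃ w, avgCoeffY i z w ≠ 0
      · obtain ⟨w, hw⟩ := hex
        exact mul_nonneg hκb0 (le_trans (norm_nonneg _) (hGb w hw))
      · -- no block term at all: the sum of weights vanishes, and the claim is trivial either way
        push Not at hex
        have : ∑ w, |avgCoeffY i z w| = 0 := Finset.sum_eq_zero fun w _ => by rw [hex w, abs_zero]
        by_cases hκG : 0 ≤ κb * Gb
        · exact hκG
        · exfalso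
          -- `z` is in its own block: `avgCoeffY i z z = levC > 0`, contradiction with `hex z`
          have hzz : avgCoeffY i z z ≠ 0 := by
            unfold avgCoeffY B4Reflection242.avgK
            rw [if_pos rfl]
            have hℓ : 1 ≤ ℓ := (side_conditions i).1
            have hL : (1 : ℝ) < (ℓ : ℝ) + 1 := by
              have : (1 : ℝ) ≤ ℓ := by exact_mod_cast hℓ
              linarith
            exact ne_of_gt (B6MultiLevelBoxOperator.levC_pos d ℓ (B1.aSeq_pos (a := (1 : ℝ)) one_pos hL ((toKT i).D.one_le_lev z.1)))
          exact hzz (hex z)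
    calc (∑ w, |avgCoeffY i z w|) * (κb * Gb) ≤ ((((ℓ : ℝ) + 1) ^ levY i z) ^ 2)⁻¹ * (κb * Gb) :=
          mul_le_mul_of_nonneg_right (sum_abs_avgCoeffY_le_levFactor i z) hGb0
      _ = ((((ℓ : ℝ) + 1) ^ levY i z) ^ 2)⁻¹ * κb * Gb := by ring

/-- the level-uniform form of the bond coefficient: `C1F∕(8∕5·S_j) ≤ (5∕8)·C1F∕(L·M_h)·(L^j)⁻¹` (`S_j = M_h·L^{j+1}`) — the `O(1)(MLʲη)⁻¹` of print with the
`L^{−j}` that cancels the `Lʲ` of the gradient entry (3.42)₂. [cite: Balaban1984PropagatorsII, p.247; Balaban1985BackgroundPropagators, (3.42) p.397, (3.89) p.409] -/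
theorem C1F_div_bigSide_eq (j : ℕ) :
    C1F d ℓ / (8 / 5 * (bigSide ℓ i.Mh j : ℝ)) = 5 / 8 * C1F d ℓ / (((ℓ : ℝ) + 1) * i.Mh) * ((((ℓ : ℝ) + 1) ^ j))⁻¹ := by
  obtain ⟨_, hMh, _, _⟩ := side_conditions i
  have hM : (0 : ℝ) < i.Mh := by exact_mod_cast (lt_of_lt_of_le (by norm_num) hMh)
  have hL0 : (0 : ℝ) < (ℓ : ℝ) + 1 := by positivity
  have hLj : (0 : ℝ) < ((ℓ : ℝ) + 1) ^ j := pow_pos hL0 j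
  rw [bigSide_eq]
  push_cast
  field_simp

/-- and of the site coefficient: `C2F∕(8∕5·S_j)² = (5∕8)²·C2F∕(L·M_h)²·(L^j)⁻²` — two powers, against the `(Lʲ)²` of the sup entry (3.42)₁.
[cite: Balaban1984PropagatorsII, p.247; Balaban1985BackgroundPropagators, (3.42) p.397, (3.89) p.409] -/
theorem C2F_div_bigSide_sq_eq (j : ℕ) :
    C2F d ℓ / (8 / 5 * (bigSide ℓ i.Mh j : ℝ)) ^ 2
      = (5 / 8) ^ 2 * C2F d ℓ / (((ℓ : ℝ) + 1) * i.Mh) ^ 2 * (((((ℓ : ℝ) + 1) ^ j)) ^ 2)⁻¹ := by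
  obtain ⟨_, hMh, _, _⟩ := side_conditions i
  have hM : (0 : ℝ) < i.Mh := by exact_mod_cast (lt_of_lt_of_le (by norm_num) hMh)
  have hL0 : (0 : ℝ) < (ℓ : ℝ) + 1 := by positivity
  have hLj : (0 : ℝ) < ((ℓ : ℝ) + 1) ^ j := pow_pos hL0 j
  rw [bigSide_eq]
  push_cast
  field_simp

end Literature.MathematicalPhysics.QuantumFieldTheory.Balaban1983to89.B9Thm37CubeCoverCommutatorSizesGrad

end
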